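import Mathlib.Analysis.Complex.Schwarz
import HarnessLib

/-!
# THE PRODUCT KERNEL OF THE MIXED BACKGROUND RESPONSE IS A CAUCHY COROLLARY OF ONE-SIDED FIRST-ORDER DECAY (abstract, Mathlib-only)

Cell `ym3-torus` (YM ladder rung R3 = continuum `SU(2)` Yang–Mills on the three-torus — a RUNG, NOT d = 4, NOT infinite volume, NOT a mass gap, NOT Clay).  Width seat
`ym-ust-20520-w5` (gen 20); `--supports stmt-QuantumFields-20520 --as helper`, count-neutral, definition-free, default heartbeats, Mathlib-only imports.

WHAT.  LINE g24-4 «background_form» (ideator `ym-r3-idea-1` g24; BGFORM∘ lifted by LEAD w3-20520 g20's ✓`…BackgroundFormKnit`) posits for the background map `M`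
(print: the minimal configuration `U_k(V)`, [Balaban1985Variational] Prop. 9 p.309) a MIXED two-bond response clause (resp2) with a PRODUCT kernel
`‖Δ_bΔ_{b′} M(e)‖ ≤ σ₂,J · e^{−2μd(πb,e)} · e^{−2μd(e,πb′)}`; the card's WHY-FAIL (f) says: «the natural Cauchy-estimate shape but NOT printed» — print states only the
FIRST-order decay (182)–(190) pp.307–308 (with its own caveat at (189)) and the analyticity of `U_k` in the small field (Prop. 9).  THIS FILE shows, in the
abstract, that the product kernel IS a corollary of those two printed-shape inputs, at HALF the rate:
* §1 `norm_sub_le_two_mul_div_of_differentiableOn_vec` — the one-variable Schwarz step for VECTOR-valued `f : ℂ → E` (`‖f z − f 0‖ ≤ (2B∕R)·‖z‖`; the `ℂ`-valued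
  special case is ✓`…BackgroundFormCauchyShape.norm_sub_le_two_mul_div_of_differentiableOn`).
* §2 ★★ `norm_mixedDiff_le_of_slice_bound` — for a two-parameter family `g : ℂ → ℂ → E`: if the `w`-RESPONSE `z ↦ g z 1 − g z 0` is complex-differentiable on
  `ball 0 R` (`1 < R`) and bounded there by `C`, then `‖g 1 1 − g 1 0 − g 0 1 + g 0 0‖ ≤ 2C∕R` (Schwarz in `z` on the response); ★★ `norm_mixedDiff_le_min` — with
  BOTH one-sided letters (the `w`-response bounded by `C₁` along the complex `z`-move, the `z`-response bounded by `C₂` along the complex `w`-move) the mixed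
  difference is `≤ min (2C₁∕R₁) (2C₂∕R₂)`.
* §3 ★★★ `norm_mixedDiff_le_prodKernel` — if the one-sided bounds DECAY, `C₁ = σ·e^{−2ν·t}` (the `b′`-response decays in the distance `t = d(e,πb′)`, uniformly
  along the complex `b`-move) and `C₂ = σ·e^{−2ν·s}` (`s = d(πb,e)`), then `min ≤` geometric mean gives the PRODUCT KERNEL AT HALF RATE:
  `‖g 1 1 − g 1 0 − g 0 1 + g 0 0‖ ≤ (2σ∕R) · e^{−ν·s} · e^{−ν·t}` (`exp_neg_max_le`: `e^{−2ν·max(s,t)} ≤ e^{−ν s}e^{−ν t}`).  So (resp2)'s shape follows from: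
  (resp1)-type first-order decay holding UNIFORMLY ALONG COMPLEX ONE-BOND MOVES of the other bond + analyticity of the response in that move — both of the shape
  print states (Prop. 9 + (190)); the price is the rate `2μ ↦ μ` and `σ₂ := 2σ∕R` (super-polynomially small with `σ`).
* §4 `pi_norm_ofReal_eq` — the coordinatewise embedding `ℝⁿ ↪ ℂⁿ` is norm-preserving (to read real second differences off complex families).
* §5 ★★★ `resp2_of_sliceLetters` — the DOCKING edition: BGFORM∘'s (resp2) clause SHAPE (binder-for-binder: `∀ b b′ U V W Z`, window, the four agreements,
  `∀ e, ‖M U e − M W e − M V e + M Z e‖ ≤ σ₂·(e^{−2μd(πb,e)}·e^{−2μd(e,πb′)})`) from SLICE LETTERS at `(σ, 4μ, R)`, with `σ₂ := 2σ∕R` — generic in the window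
  predicate, anchor, pseudo-metric and real-coordinate background map, so a BGFORM∘∕BGFORMᵃ∘ supplier discharges (resp2) by `exact`.

HONEST SCOPE.  Schwarz lemma + `min ≤ geometric mean`; nothing of Bałaban's is asserted or proved; (resp1)∕(resp2)∕BGFORM∘∕S2β∕`FluctuationComparisonRegPrIntL` (20520)
NOT proved; no summit is proved by a helper; rung R3 = SU(2) YM₃ on T³ — NOT d = 4, NOT infinite volume, NOT a mass gap, NOT Clay.  Sorry-free, axioms standard.

References: T. Bałaban, CMP **102** (1985) 277–309 [Balaban1985Variational] (Sect. G p.305, Prop. 9 p.309, (182)–(190) pp.307–308); CMP **109** (1987) 249–301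
[Balaban1987RG1] ((1.11)–(1.14) p.262).
-/

set_option autoImplicit false

noncomputable section

namespace Summit.QuantumFields.YangMills.Theorems.FluctuationComparisonRegPrIntLBackgroundFormResponseCauchy

open Set Metric

section Vec

variable {E : Type*} [NormedAddCommGroup E] [NormedSpace ℂ E]

/-- **The vector-valued one-variable Schwarz step**: `f : ℂ → E` differentiable on `ball 0 R`, `1 < R`, `‖f z‖ ≤ B` there ⟹ `‖f z − f 0‖ ≤ (2B∕R)·‖z‖` on
the ball (`Complex.dist_le_div_mul_dist_of_mapsTo_ball`). [cite: Balaban1985Variational, Prop. 9 p.309] -/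
theorem norm_sub_le_two_mul_div_of_differentiableOn_vec {f : ℂ → E} {R B : ℝ} (hR : 1 < R) (hf : DifferentiableOn ℂ f (ball 0 R))
    (hB : ∀ z ∈ ball (0 : ℂ) R, ‖f z‖ ≤ B) (z : ℂ) (hz : z ∈ ball (0 : ℂ) R) : ‖f z - f 0‖ ≤ 2 * B / R * ‖z‖ := by
  have h0 : (0 : ℂ) ∈ ball (0 : ℂ) R := mem_ball_self (by linarith)
  have hmaps : MapsTo f (ball (0 : ℂ) R) (closedBall (f 0) (2 * B)) := by
    intro y hy
    rw [mem_closedBall, dist_eq_norm]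
    calc ‖f y - f 0‖ ≤ ‖f y‖ + ‖f 0‖ := norm_sub_le _ _
      _ ≤ B + B := add_le_add (hB y hy) (hB 0 h0)
      _ = 2 * B := by ring
  have h := Complex.dist_le_div_mul_dist_of_mapsTo_ball hf hmaps hz
  rw [dist_eq_norm, dist_zero_right] at h
  exact h

/-- ★★ **MIXED DIFFERENCE FROM ONE SLICE LETTER.**  For `g : ℂ → ℂ → E`: if the `w`-response `z ↦ g z 1 − g z 0` is complex-differentiable on `ball 0 R` (`1 < R`)
and bounded there by `C`, then `‖g 1 1 − g 1 0 − g 0 1 + g 0 0‖ ≤ 2C∕R`. [cite: Balaban1985Variational, Prop. 9 p.309 and (190) p.308] -/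
theorem norm_mixedDiff_le_of_slice_bound {g : ℂ → ℂ → E} {R C : ℝ} (hR : 1 < R)
    (hψ : DifferentiableOn ℂ (fun z => g z 1 - g z 0) (ball 0 R)) (hψB : ∀ z ∈ ball (0 : ℂ) R, ‖g z 1 - g z 0‖ ≤ C) :
    ‖g 1 1 - g 1 0 - g 0 1 + g 0 0‖ ≤ 2 * C / R := by
  have h1 : (1 : ℂ) ∈ ball (0 : ℂ) R := by rw [mem_ball, dist_zero_right, norm_one]; exact hR
  have key := norm_sub_le_two_mul_div_of_differentiableOn_vec hR hψ hψB 1 h1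
  have hrw : g 1 1 - g 1 0 - g 0 1 + g 0 0 = (g 1 1 - g 1 0) - (g 0 1 - g 0 0) := by abel
  rw [hrw]
  simpa using key

/-- ★★ **BOTH SLICE LETTERS ⇒ `min`.**  If moreover the `z`-response `w ↦ g 1 w − g 0 w` is complex-differentiable on `ball 0 R₂` and bounded by `C₂`, then
`‖g 1 1 − g 1 0 − g 0 1 + g 0 0‖ ≤ min (2C₁∕R₁) (2C₂∕R₂)`. [cite: Balaban1985Variational, Prop. 9 p.309 and (190) p.308] -/
theorem norm_mixedDiff_le_min {g : ℂ → ℂ → E} {R₁ R₂ C₁ C₂ : ℝ} (hR₁ : 1 < R₁) (hR₂ : 1 < R₂)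
    (hψ : DifferentiableOn ℂ (fun z => g z 1 - g z 0) (ball 0 R₁)) (hψB : ∀ z ∈ ball (0 : ℂ) R₁, ‖g z 1 - g z 0‖ ≤ C₁)
    (hχ : DifferentiableOn ℂ (fun w => g 1 w - g 0 w) (ball 0 R₂)) (hχB : ∀ w ∈ ball (0 : ℂ) R₂, ‖g 1 w - g 0 w‖ ≤ C₂) :
    ‖g 1 1 - g 1 0 - g 0 1 + g 0 0‖ ≤ min (2 * C₁ / R₁) (2 * C₂ / R₂) := by
  refine le_min (norm_mixedDiff_le_of_slice_bound hR₁ hψ hψB) ?_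
  -- the transposed family
  have := norm_mixedDiff_le_of_slice_bound (g := fun w z => g z w) hR₂ hχ hχB
  have hrw : g 1 1 - g 1 0 - g 0 1 + g 0 0 = g 1 1 - g 0 1 - g 1 0 + g 0 0 := by abel
  rw [hrw]
  simpa using this

end Vec

/-! ## §3 Decaying one-sided letters ⇒ the product kernel at half rate -/

/-- `min ≤` geometric mean for decaying bounds: `e^{−2ν·max(s,t)} ≤ e^{−ν s}·e^{−ν t}` when `0 ≤ ν`, i.e. `min (e^{−2νs}) (e^{−2νt}) ≤ e^{−νs} e^{−νt}`.
[cite: Balaban1985Variational, (190) p.308] -/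
theorem min_exp_le_exp_mul_exp (ν s t : ℝ) (hν : 0 ≤ ν) :
    min (Real.exp (-(2 * ν * s))) (Real.exp (-(2 * ν * t))) ≤ Real.exp (-(ν * s)) * Real.exp (-(ν * t)) := by
  rw [← Real.exp_add]
  rcases le_total s t with hst | hts
  · refine (min_le_right _ _).trans ?_
    rw [Real.exp_le_exp]; nlinarith
  · refine (min_le_left _ _).trans ?_
    rw [Real.exp_le_exp]; nlinarith

section Prod

variable {E : Type*} [NormedAddCommGroup E] [NormedSpace ℂ E]

/-- ★★★ **THE PRODUCT KERNEL AT HALF RATE.**  Let `g : ℂ → ℂ → E` be a two-parameter family (reading: the background coordinate `M(·)(e)` along the complex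
one-bond moves of `b` (parameter `z`) and `b′` (parameter `w`), corners = the window square).  Assume, on `ball 0 R` (`1 < R`): the `b′`-response
`z ↦ g z 1 − g z 0` is complex-differentiable and bounded by `σ·e^{−2ν·t}` (first-order decay in `t = d(e,πb′)`, UNIFORMLY along the complex `b`-move), and the
`b`-response `w ↦ g 1 w − g 0 w` is complex-differentiable and bounded by `σ·e^{−2ν·s}` (`s = d(πb,e)`), with `0 ≤ σ`, `0 ≤ ν`.  Then
`‖g 1 1 − g 1 0 − g 0 1 + g 0 0‖ ≤ (2σ∕R) · e^{−ν s} · e^{−ν t}` — the mixed-response clause (resp2) of BGFORM∘ with `σ₂ := 2σ∕R` and rate `ν` (half of the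
one-sided rate `2ν`).  [cite: Balaban1985Variational, Prop. 9 p.309 and (182)-(190) pp.307-308] -/
theorem norm_mixedDiff_le_prodKernel {g : ℂ → ℂ → E} {R σ ν s t : ℝ} (hR : 1 < R) (hσ : 0 ≤ σ) (hν : 0 ≤ ν)
    (hψ : DifferentiableOn ℂ (fun z => g z 1 - g z 0) (ball 0 R)) (hψB : ∀ z ∈ ball (0 : ℂ) R, ‖g z 1 - g z 0‖ ≤ σ * Real.exp (-(2 * ν * t)))
    (hχ : DifferentiableOn ℂ (fun w => g 1 w - g 0 w) (ball 0 R)) (hχB : ∀ w ∈ ball (0 : ℂ) R, ‖g 1 w - g 0 w‖ ≤ σ * Real.exp (-(2 * ν * s))) :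
    ‖g 1 1 - g 1 0 - g 0 1 + g 0 0‖ ≤ 2 * σ / R * (Real.exp (-(ν * s)) * Real.exp (-(ν * t))) := by
  have hRpos : 0 < R := by linarith
  have key := norm_mixedDiff_le_min hR hR hψ hψB hχ hχB
  refine key.trans ?_
  have hc : 0 ≤ 2 * σ / R := by positivity
  rcases le_total s t with hst | hts
  · refine (min_le_left _ _).trans ?_
    have h2 : Real.exp (-(2 * ν * t)) ≤ Real.exp (-(ν * s)) * Real.exp (-(ν * t)) := by
      rw [← Real.exp_add, Real.exp_le_exp]; nlinarith
    calc 2 * (σ * Real.exp (-(2 * ν * t))) / R = 2 * σ / R * Real.exp (-(2 * ν * t)) := by ring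
      _ ≤ 2 * σ / R * (Real.exp (-(ν * s)) * Real.exp (-(ν * t))) := mul_le_mul_of_nonneg_left h2 hc
  · refine (min_le_right _ _).trans ?_
    have h2 : Real.exp (-(2 * ν * s)) ≤ Real.exp (-(ν * s)) * Real.exp (-(ν * t)) := by
      rw [← Real.exp_add, Real.exp_le_exp]; nlinarith
    calc 2 * (σ * Real.exp (-(2 * ν * s))) / R = 2 * σ / R * Real.exp (-(2 * ν * s)) := by ring
      _ ≤ 2 * σ / R * (Real.exp (-(ν * s)) * Real.exp (-(ν * t))) := mul_le_mul_of_nonneg_left h2 hc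

end Prod

/-! ## §4 Reading real coordinates off complex families -/

/-- The coordinatewise embedding `ℝ⁸ ↪ ℂ⁸` preserves the sup norm. [cite: Balaban1987RG1, (1.11)-(1.14) p.262] -/
theorem pi_norm_ofReal_eq {n : ℕ} (x : Fin n → ℝ) : ‖(fun i => (x i : ℂ))‖ = ‖x‖ := by
  refine le_antisymm ?_ ?_
  · exact (pi_norm_le_iff_of_nonneg (norm_nonneg x)).mpr fun i => by rw [Complex.norm_real]; exact norm_le_pi_norm x i
  · refine (pi_norm_le_iff_of_nonneg (norm_nonneg _)).mpr fun i => ?_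
    rw [← Complex.norm_real]
    exact norm_le_pi_norm (fun i => (x i : ℂ)) i

/-! ## §5 DOCKING EDITION: BGFORM∘'s mixed-response clause (resp2) from SLICE LETTERS (first-order decay along complex one-bond moves + analyticity) -/

section Resp2

variable {ι G E : Type*} {n : ℕ}

/-- ★★★ **(resp2) FROM SLICE LETTERS.**  Generic in the window-bond type `ι`, the value type `G`, the background-bond type `E`, the window predicate `P`, the
anchor `π`, the pseudo-metric `d`, and a real-coordinate background map `M : (ι → G) → E → (Fin n → ℝ)`.  SLICE LETTERS at `(σ, 4μ, R)`: for every window square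
`U V W Z` (corners pairwise agreeing off `b` ∕ `b′` as in BGFORM∘) and every background bond `e` there is a two-parameter family `g : ℂ → ℂ → ℂⁿ` through the
four embedded corners (`g 0 0 = Z`, `g 1 0 = W`, `g 0 1 = V`, `g 1 1 = U` at `e`) whose `b′`-RESPONSE `z ↦ g z 1 − g z 0` is complex-differentiable on `ball 0 R` and
bounded by `σ·e^{−4μ·d(e,πb′)}` (first-order decay, uniformly along the complex `b`-move) and whose `b`-RESPONSE `w ↦ g 1 w − g 0 w` is complex-differentiable on
`ball 0 R` and bounded by `σ·e^{−4μ·d(πb,e)}`.  CONCLUSION = BGFORM∘'s (resp2) clause SHAPE with `σ₂ := 2σ∕R` and rate `2μ`: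
`‖M U e − M W e − M V e + M Z e‖ ≤ (2σ∕R)·(e^{−2μ d(πb,e)}·e^{−2μ d(e,πb′)})`.  Reading: [Balaban1985Variational] Prop. 9 (analyticity of `U_k` in the small field) +
(190) (first-order decay of `δU_k∕δV`), through `norm_mixedDiff_le_prodKernel`; the card's WHY-FAIL (f) «product kernel not printed» becomes «first-order decay
along COMPLEX moves», at half the rate. [cite: Balaban1985Variational, Prop. 9 p.309 and (182)-(190) pp.307-308] -/
theorem resp2_of_sliceLetters (P : (ι → G) → Prop) (π : ι → E) (d : E → E → ℝ) (M : (ι → G) → E → (Fin n → ℝ))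
    {σ μ R : ℝ} (hR : 1 < R) (hσ : 0 ≤ σ) (hμ : 0 ≤ μ)
    (hslice : ∀ (b b' : ι) (U V W Z : ι → G), P U → P V → P W → P Z →
      (∀ e, e ≠ b → U e = V e) → (∀ e, e ≠ b' → U e = W e) → (∀ e, e ≠ b' → V e = Z e) → (∀ e, e ≠ b → W e = Z e) →
      ∀ e : E, ∃ g : ℂ → ℂ → (Fin n → ℂ),
        g 0 0 = (fun i => (M Z e i : ℂ)) ∧ g 1 0 = (fun i => (M W e i : ℂ)) ∧ g 0 1 = (fun i => (M V e i : ℂ)) ∧ g 1 1 = (fun i => (M U e i : ℂ)) ∧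
        DifferentiableOn ℂ (fun z => g z 1 - g z 0) (ball 0 R) ∧
        (∀ z ∈ ball (0 : ℂ) R, ‖g z 1 - g z 0‖ ≤ σ * Real.exp (-(4 * μ * d e (π b')))) ∧
        DifferentiableOn ℂ (fun w => g 1 w - g 0 w) (ball 0 R) ∧
        (∀ w ∈ ball (0 : ℂ) R, ‖g 1 w - g 0 w‖ ≤ σ * Real.exp (-(4 * μ * d (π b) e)))) :
    ∀ (b b' : ι) (U V W Z : ι → G), P U → P V → P W → P Z →
      (∀ e, e ≠ b → U e = V e) → (∀ e, e ≠ b' → U e = W e) → (∀ e, e ≠ b' → V e = Z e) → (∀ e, e ≠ b → W e = Z e) →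
      ∀ e : E, ‖M U e - M W e - M V e + M Z e‖ ≤
        2 * σ / R * (Real.exp (-(2 * μ * d (π b) e)) * Real.exp (-(2 * μ * d e (π b')))) := by
  intro b b' U V W Z hU hV hW hZ hUV hUW hVZ hWZ e
  obtain ⟨g, h00, h10, h01, h11, hψ, hψB, hχ, hχB⟩ := hslice b b' U V W Z hU hV hW hZ hUV hUW hVZ hWZ e
  have h2μ : 0 ≤ 2 * μ := by positivity
  have key := norm_mixedDiff_le_prodKernel (ν := 2 * μ) (s := d (π b) e) (t := d e (π b')) hR hσ h2μ hψ
    (fun z hz => by have := hψB z hz; convert this using 2; ring_nf) hχ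
    (fun w hw => by have := hχB w hw; convert this using 2; ring_nf)
  rw [h00, h10, h01, h11] at key
  have hemb : (fun i => (M U e i : ℂ)) - (fun i => (M W e i : ℂ)) - (fun i => (M V e i : ℂ)) + (fun i => (M Z e i : ℂ)) =
      fun i => ((M U e - M W e - M V e + M Z e) i : ℂ) := by
    funext i; simp [Complex.ofReal_sub, Complex.ofReal_add]
  rw [hemb, pi_norm_ofReal_eq] at key
  have hrw : -(2 * μ * d (π b) e) = -((2 * μ) * d (π b) e) := by ring
  have hrw' : -(2 * μ * d e (π b')) = -((2 * μ) * d e (π b')) := by ring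
  rw [hrw, hrw']
  exact key


/-- ★★★ **(resp2) FROM SLICE LETTERS — PROFILE EDITION (v1.1 append; serves LINE g24-4 v2's coarse-cell typing).**  Same as `resp2_of_sliceLetters` with the two
anchored distances `d (π b) e`, `d e (π b′)` replaced by ARBITRARY profiles `D₁ : ι → E → ℝ` (distance of the background bond `e` from the `b`-move) and
`D₂ : E → ι → ℝ` (from the `b′`-move): SLICE LETTERS at `(σ, 4μ, R)` with decay `e^{−4μ·D₂ e b′}` for the `b′`-response along the complex `b`-move and
`e^{−4μ·D₁ b e}` for the `b`-response ⟹ `‖M U e − M W e − M V e + M Z e‖ ≤ (2σ∕R)·(e^{−2μ D₁ b e}·e^{−2μ D₂ e b′})`.  For v2 (`Lines/background_form.lean`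
22880983 (r2)): `D₁ b e := d b (blk e)`, `D₂ e b′ := d (blk e) b′` on the COARSE pseudo-metric through the cell map `blk`; for v1: `D₁ b e := d (π b) e`,
`D₂ e b′ := d e (π b′)`. [cite: Balaban1985Variational, Prop. 9 p.309 and (182)-(190) pp.307-308] -/
theorem resp2_of_sliceLetters_profile (P : (ι → G) → Prop) (D₁ : ι → E → ℝ) (D₂ : E → ι → ℝ) (M : (ι → G) → E → (Fin n → ℝ))
    {σ μ R : ℝ} (hR : 1 < R) (hσ : 0 ≤ σ) (hμ : 0 ≤ μ)
    (hslice : ∀ (b b' : ι) (U V W Z : ι → G), P U → P V → P W → P Z →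
      (∀ e, e ≠ b → U e = V e) → (∀ e, e ≠ b' → U e = W e) → (∀ e, e ≠ b' → V e = Z e) → (∀ e, e ≠ b → W e = Z e) →
      ∀ e : E, ∃ g : ℂ → ℂ → (Fin n → ℂ),
        g 0 0 = (fun i => (M Z e i : ℂ)) ∧ g 1 0 = (fun i => (M W e i : ℂ)) ∧ g 0 1 = (fun i => (M V e i : ℂ)) ∧ g 1 1 = (fun i => (M U e i : ℂ)) ∧
        DifferentiableOn ℂ (fun z => g z 1 - g z 0) (ball 0 R) ∧
        (∀ z ∈ ball (0 : ℂ) R, ‖g z 1 - g z 0‖ ≤ σ * Real.exp (-(4 * μ * D₂ e b'))) ∧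
        DifferentiableOn ℂ (fun w => g 1 w - g 0 w) (ball 0 R) ∧
        (∀ w ∈ ball (0 : ℂ) R, ‖g 1 w - g 0 w‖ ≤ σ * Real.exp (-(4 * μ * D₁ b e)))) :
    ∀ (b b' : ι) (U V W Z : ι → G), P U → P V → P W → P Z →
      (∀ e, e ≠ b → U e = V e) → (∀ e, e ≠ b' → U e = W e) → (∀ e, e ≠ b' → V e = Z e) → (∀ e, e ≠ b → W e = Z e) →
      ∀ e : E, ‖M U e - M W e - M V e + M Z e‖ ≤
        2 * σ / R * (Real.exp (-(2 * μ * D₁ b e)) * Real.exp (-(2 * μ * D₂ e b'))) := by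
  intro b b' U V W Z hU hV hW hZ hUV hUW hVZ hWZ e
  obtain ⟨g, h00, h10, h01, h11, hψ, hψB, hχ, hχB⟩ := hslice b b' U V W Z hU hV hW hZ hUV hUW hVZ hWZ e
  have h2μ : 0 ≤ 2 * μ := by positivity
  have key := norm_mixedDiff_le_prodKernel (ν := 2 * μ) (s := D₁ b e) (t := D₂ e b') hR hσ h2μ hψ
    (fun z hz => by have := hψB z hz; convert this using 2; ring_nf) hχ
    (fun w hw => by have := hχB w hw; convert this using 2; ring_nf)
  rw [h00, h10, h01, h11] at key
  have hemb : (fun i => (M U e i : ℂ)) - (fun i => (M W e i : ℂ)) - (fun i => (M V e i : ℂ)) + (fun i => (M Z e i : ℂ)) =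
      fun i => ((M U e - M W e - M V e + M Z e) i : ℂ) := by
    funext i; simp [Complex.ofReal_sub, Complex.ofReal_add]
  rw [hemb, pi_norm_ofReal_eq] at key
  have hrw : -(2 * μ * D₁ b e) = -((2 * μ) * D₁ b e) := by ring
  have hrw' : -(2 * μ * D₂ e b') = -((2 * μ) * D₂ e b') := by ring
  rw [hrw, hrw']
  exact key

end Resp2

end Summit.QuantumFields.YangMills.Theorems.FluctuationComparisonRegPrIntLBackgroundFormResponseCauchy
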